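import Summits.BirchSwinnertonDyer.BirchSwinnertonDyer.Theorems.SmallImageMuTransferMuTransferX9StepTwoElementKernels
import Summits.BirchSwinnertonDyer.BirchSwinnertonDyer.Theorems.OneSidedTwistSqueezeX9KatoDivisibilityX9DepthElementPk
import HarnessLib

set_option autoImplicit false

-- the summit and its single problem are both named `BirchSwinnertonDyer` (registry layout D-0017)
set_option linter.dupNamespace false

/-!
# STEP 2 at `p`-level `k`: the Chebotarev prime with Frobenius in `ker ρ_{E,p^k}`, prescribed joint value on
# `H' = N_J(κ) ⊓ N_{J'}(κ⁻¹) ⊓ ker ρ_{E,p^k}` and depth exactly `n ≥ n₁` — the Chebotarev half of `stub_kolyvaginPrimePkX9`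

Seat `bsd-line-k6-p4` (prover-bsd-line-k6-p4-g4-0, 4th LEAD on crux stmt-BirchSwinnertonDyer-20547, line `graded_euler_loss`,
skeleton v3).  THEOREMS ONLY, sorry-free, no definition, nothing asserted about any curve beyond what the kernel proves.
`--supports stmt-BirchSwinnertonDyer-20547`.  Port of `…X9StepTwoElement` §4 / `…X9StepTwoElementKernels` §7 (MU-TRANSFER-PROOF
§5 STEP 2) with `ker ρ̄_{E,p}` replaced by `ker ρ_{E,p^k}`; the only new input is the THRESHOLD `n₁` of the depth element
(`…DepthElementPk.exists_threshold_mem_ker_inf_layerSubgroup_not_mem_succ`): the joint-value transport on a normal subgroup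
acting trivially on the two mod-`p` twists (`exists_mem_apply_eq_and_apply_eq_of_ne_two`, central MOD-`p` scalar) is level-free.

* `ker_galoisRepTorsion_pow_le` — `ker ρ_{E,p^k} ≤ ker ρ̄_{E,p}` (`k ≥ 1`);
* `exists_threshold_mem_apply_eq_and_depth_pk_of_ne_two` — ∃ n₁ ∀ n ≥ n₁: on any normal `H` acting trivially on
  `𝒯_J(E,κ)`, `𝒯_{J'}(E,κ')` with `ker ρ_{E,p^k} ⊓ Gal(ℚ̄/ℚ_n) ≤ H ≤ ker ρ_{E,p^k}`, every joint value of `(φ, ψ)` on `H` is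
  realised by `σ ∈ H` with `ρ_{E,p^k}(σ) = 1`, `σ ∈ Gal(ℚ̄/ℚ_n) ∖ Gal(ℚ̄/ℚ_{n+1})`;
* `exists_threshold_isArithFrobAt_mem_apply_eq_and_depth_pk_of_ne_two` — END-TO-END: ∃ n₁ ∀ n ≥ n₁, for `1 ≤ J ≤ pⁿ`,
  `J' ≤ pⁿ`, every joint value `w` of `(φ, ψ)` on `H' = N_J(κ) ⊓ N_{J'}(κ⁻¹) ⊓ ker ρ_{E,p^k}` and every finite `S`: an open
  normal `N ≤ H' ⊓ Gal(ℚ̄/ℚ_{n+1})` killed by `φ, ψ`, a place `v ∉ S` unramified for `N` and an arithmetic Frobenius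
  `Fr ∈ H'` above it with `(φ Fr, ψ Fr) = w`, `ρ_{E,p^k}(Fr) = 1`, `Fr ∈ Gal(ℚ̄/ℚ_n) ∖ Gal(ℚ̄/ℚ_{n+1})`.
  With `k = d+1` this is exactly the Frobenius `stub_kolyvaginPrimePkX9` needs, GIVEN a good joint value on `H'` (Lemma
  5.7.B with defect — the other half of that stub).

References: J.-P. Serre, Invent. Math. 15 (1972) §2.4 Prop. 15, §2.6 [Serre1972]; C.-H. Sah, J. Algebra 10 (1968) Prop. 2.7 (b)
[Sah1968]; J. Tate, Cassels–Fröhlich VII §2.4 [TateGCFT1967]; HOME/MEMO-es.md §15 STEP 2.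
-/

noncomputable section

open Field WeierstrassCurve Literature.NumberTheory.EllipticCurves Literature.NumberTheory.GaloisRepresentations Function
open Summit.BirchSwinnertonDyer.BirchSwinnertonDyer.Rank1Residual
open Summit.BirchSwinnertonDyer.BirchSwinnertonDyer.Theorems.OneSidedTwistSqueezeX9KatoDivisibilityX9DepthElementPk

namespace Summit.BirchSwinnertonDyer.BirchSwinnertonDyer.Theorems.OneSidedTwistSqueezeX9KatoDivisibilityX9ChebotarevPk

/-! ## §1 `ker ρ_{E,p^k} ≤ ker ρ̄_{E,p}` -/

section Kernels

universe u

variable {F : Type u} [Field F] (W : WeierstrassCurve F) (p : ℕ)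

/-- An element acting trivially on `E[p^k]` (`k ≥ 1`) acts trivially on `E[p] ⊆ E[p^k]`. [folklore] -/
theorem ker_galoisRepTorsion_pow_le {k : ℕ} (hk : 1 ≤ k) :
    (galoisRepTorsion W ((p : ℤ) ^ k)).ker ≤ (galoisRepTorsion W (p : ℤ)).ker := by
  intro σ hσ
  rw [MonoidHom.mem_ker] at hσ ⊢
  apply Multiplicative.toAdd.injective
  refine AddEquiv.ext fun P => ?_
  rw [galoisRepTorsion_apply, toAdd_one, AddAut.zero_apply]
  -- view `P` inside `E[p^k]`
  have hP : (P : geomPoints W) ∈ geomTorsion W ((p : ℤ) ^ k) := by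
    have h := P.2
    simp only [Submodule.mem_toAddSubgroup, Submodule.mem_torsionBy_iff] at h ⊢
    obtain ⟨j, hj⟩ : ∃ j, k = j + 1 := ⟨k - 1, by omega⟩
    rw [hj, pow_succ, mul_smul, h, smul_zero]
  have h1 := congrArg (fun z : geomTorsion W ((p : ℤ) ^ k) => (z : geomPoints W))
    (show σ • (⟨(P : geomPoints W), hP⟩ : geomTorsion W ((p : ℤ) ^ k)) = ⟨(P : geomPoints W), hP⟩ by
      rw [← galoisRepTorsion_apply, hσ]; rfl)
  apply Subtype.ext
  simpa [Literature.NumberTheory.EllipticCurves.AddSubgroup.torsionBy.coe_smul] using h1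

end Kernels

/-! ## §2 Over `ℚ`: the coset representative and the Chebotarev prime at `p`-level `k` -/

section Rat

open scoped NumberField
open IsDedekindDomain NumberField

variable (W : WeierstrassCurve ℚ) [W.IsElliptic] (p : ℕ) [Fact p.Prime] (κ κ' : ZpExtension ℚ p)

/-- **STEP 2's coset representative at `p`-level `k` (threshold form).**  `p` odd, `E[p]` irreducible, `ρ̄_{E,p}` not onto,
`κ'` with the same kernel as `κ`, any `k`: there is `n₁` such that for every `n ≥ n₁`, every normal `H` acting trivially on
`𝒯_J(E,κ)` and `𝒯_{J'}(E,κ')` with `ker ρ_{E,p^k} ⊓ Gal(ℚ̄/ℚ_n) ≤ H ≤ ker ρ_{E,p^k}`, every joint value `w` of `(φ, ψ)` on `H`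
is `(φ σ, ψ σ)` for some `σ ∈ H` with `ρ_{E,p^k}(σ) = 1`, `σ ∈ Gal(ℚ̄/ℚ_n)`, `σ ∉ Gal(ℚ̄/ℚ_{n+1})` (joint-value transport with the
mod-`p` central scalar, then the level-`p^k` depth element). [cite: Serre1972, §2.4 Prop. 15 and §2.6] [cite: Sah1968, Prop. 2.7 (b)] -/
theorem exists_threshold_mem_apply_eq_and_depth_pk_of_ne_two (hp2 : p ≠ 2)
    (hirr : W.HasIrreducibleModPGaloisRep p) (hns : ¬ W.HasSurjectiveModNGaloisRep p)
    (hker : κ'.kerSubgroup = κ.kerSubgroup) (k : ℕ) :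
    ∃ n₁ : ℕ, ∀ (n : ℕ), n₁ ≤ n → ∀ (J J' : ℕ)
      (φ : contOneCocycles (W.modPTwist p κ J).toTopRep)
      (ψ : contOneCocycles (W.modPTwist p κ' J').toTopRep)
      (H : Subgroup (absoluteGaloisGroup ℚ)) [H.Normal]
      (hX : ∀ τ ∈ H, ∀ x : (W.modPTwist p κ J).toTopRep, (W.modPTwist p κ J).toTopRep.ρ τ x = x)
      (hY : ∀ τ ∈ H, ∀ y : (W.modPTwist p κ' J').toTopRep, (W.modPTwist p κ' J').toTopRep.ρ τ y = y),
      (galoisRepTorsion W ((p : ℤ) ^ k)).ker ⊓ κ.layerSubgroup n ≤ H →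
      H ≤ (galoisRepTorsion W ((p : ℤ) ^ k)).ker →
      ∀ {w : (W.modPTwist p κ J).toTopRep × (W.modPTwist p κ' J').toTopRep},
        w ∈ contOneCocycles.jointValueSubgroup φ ψ H hX hY →
        ∃ σ ∈ H, φ.1 σ = w.1 ∧ ψ.1 σ = w.2 ∧ galoisRepTorsion W ((p : ℤ) ^ k) σ = 1 ∧
          σ ∈ κ.layerSubgroup n ∧ σ ∉ κ.layerSubgroup (n + 1) := by
  have hp : p.Prime := Fact.out
  have hn₀ : ((p : ℤ) ^ k) ≠ 0 := pow_ne_zero _ (by exact_mod_cast hp.ne_zero)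
  obtain ⟨n₁, hn₁⟩ := exists_threshold_mem_ker_inf_layerSubgroup_not_mem_succ κ W hn₀
  refine ⟨n₁, fun n hn J J' φ ψ H _ hX hY hH hHker w hw => ?_⟩
  obtain ⟨σ₁, hσ₁, -, hσ₁'⟩ := hn₁ n hn
  obtain ⟨σ, hσ, hκσ, hφ, hψ⟩ := exists_mem_apply_eq_and_apply_eq_of_ne_two W p κ κ' hp2 hirr hns hker J J' φ ψ H
    hX hY (hH hσ₁) hw
  refine ⟨σ, hσ, hφ, hψ, MonoidHom.mem_ker.mp (hHker hσ), ?_, ?_⟩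
  · exact (mem_layerSubgroup_iff_of_apply_eq p κ hκσ n).mpr (Subgroup.mem_inf.mp hσ₁).2
  · exact fun h => hσ₁' ((mem_layerSubgroup_iff_of_apply_eq p κ hκσ (n + 1)).mp h)

/-- **STEP 2 at `p`-level `k`, END-TO-END** (the Chebotarev half of `stub_kolyvaginPrimePkX9`).  `p` odd, `E[p]` irreducible,
`ρ̄_{E,p}` not onto, `k ≥ 1`: there is `n₁` such that for every `n ≥ n₁`, `1 ≤ J ≤ pⁿ`, `J' ≤ pⁿ`, cocycles `φ`, `ψ` in
`𝒯_J(E,κ)`, `𝒯_{J'}(E,κ⁻¹)`, every joint value `w` of `(φ, ψ)` on `H' = N_J(κ) ⊓ N_{J'}(κ⁻¹) ⊓ ker ρ_{E,p^k}` and every finite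
set `S` of places: there are an open normal `N ≤ H'`, `N ≤ Gal(ℚ̄/ℚ_{n+1})`, killed by `φ` and `ψ`, and a place `v ∉ S`
unramified for `N` with an arithmetic Frobenius `Fr ∈ H'` above it such that `(φ Fr, ψ Fr) = w`, `ρ_{E,p^k}(Fr) = 1`,
`Fr ∈ Gal(ℚ̄/ℚ_n) ∖ Gal(ℚ̄/ℚ_{n+1})`. [cite: Serre1972, §2.4 Prop. 15 and §2.6] [cite: Sah1968, Prop. 2.7 (b)]
[cite: TateGCFT1967, §2.4 (Tchebotarev density theorem) with Prop. 2.3] -/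
theorem exists_threshold_isArithFrobAt_mem_apply_eq_and_depth_pk_of_ne_two (hp2 : p ≠ 2)
    (hirr : W.HasIrreducibleModPGaloisRep p) (hns : ¬ W.HasSurjectiveModNGaloisRep p) {k : ℕ} (hk : 1 ≤ k) :
    ∃ n₁ : ℕ, ∀ (n : ℕ), n₁ ≤ n → ∀ {J J' : ℕ}, 0 < J → J ≤ p ^ n → J' ≤ p ^ n →
      ∀ (φ : contOneCocycles (W.modPTwist p κ J).toTopRep)
        (ψ : contOneCocycles (W.modPTwist p κ.invTwist J').toTopRep)
        {w : (W.modPTwist p κ J).toTopRep × (W.modPTwist p κ.invTwist J').toTopRep},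
        w ∈ contOneCocycles.jointValueSubgroup φ ψ
          (((κ.twistModPRepresentation (W.torsionGaloisModule (p : ℤ))
              (fun P : geomTorsion W (p : ℤ) => AddSubgroup.torsionBy.nsmul P) J).ker ⊓
            (κ.invTwist.twistModPRepresentation (W.torsionGaloisModule (p : ℤ))
              (fun P : geomTorsion W (p : ℤ) => AddSubgroup.torsionBy.nsmul P) J').ker) ⊓
            (galoisRepTorsion W ((p : ℤ) ^ k)).ker)
          (fun _ hτ x => κ.toTopRep_ρ_apply_eq_self_of_mem_ker (W.torsionGaloisModule (p : ℤ)) _ J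
            (Subgroup.mem_inf.mp (Subgroup.mem_inf.mp hτ).1).1 x)
          (fun _ hτ y => κ.invTwist.toTopRep_ρ_apply_eq_self_of_mem_ker (W.torsionGaloisModule (p : ℤ)) _ J'
            (Subgroup.mem_inf.mp (Subgroup.mem_inf.mp hτ).1).2 y) →
        ∀ (S : Set (HeightOneSpectrum (𝓞 ℚ))), S.Finite →
        ∃ N : Subgroup (absoluteGaloisGroup ℚ), N.Normal ∧ IsOpen (N : Set (absoluteGaloisGroup ℚ)) ∧
          N ≤ ((κ.twistModPRepresentation (W.torsionGaloisModule (p : ℤ))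
              (fun P : geomTorsion W (p : ℤ) => AddSubgroup.torsionBy.nsmul P) J).ker ⊓
            (κ.invTwist.twistModPRepresentation (W.torsionGaloisModule (p : ℤ))
              (fun P : geomTorsion W (p : ℤ) => AddSubgroup.torsionBy.nsmul P) J').ker) ⊓
            (galoisRepTorsion W ((p : ℤ) ^ k)).ker ∧
          N ≤ κ.layerSubgroup (n + 1) ∧ (∀ σ ∈ N, φ.1 σ = 0) ∧ (∀ σ ∈ N, ψ.1 σ = 0) ∧
          ∃ v ∉ S, SubgroupIsUnramifiedAt ℚ N v ∧
            ∃ 𝔓 ∈ v.primesAbove, ∃ Fr : absoluteGaloisGroup ℚ, IsArithFrobAt (𝓞 ℚ) Fr 𝔓 ∧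
              Fr ∈ ((κ.twistModPRepresentation (W.torsionGaloisModule (p : ℤ))
                  (fun P : geomTorsion W (p : ℤ) => AddSubgroup.torsionBy.nsmul P) J).ker ⊓
                (κ.invTwist.twistModPRepresentation (W.torsionGaloisModule (p : ℤ))
                  (fun P : geomTorsion W (p : ℤ) => AddSubgroup.torsionBy.nsmul P) J').ker) ⊓
                (galoisRepTorsion W ((p : ℤ) ^ k)).ker ∧
              φ.1 Fr = w.1 ∧ ψ.1 Fr = w.2 ∧ galoisRepTorsion W ((p : ℤ) ^ k) Fr = 1 ∧
              Fr ∈ κ.layerSubgroup n ∧ Fr ∉ κ.layerSubgroup (n + 1) := by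
  have hp : p.Prime := Fact.out
  haveI : Finite (geomTorsion W (p : ℤ)) :=
    WeierstrassCurve.finite_torsionPoints_holds W (AlgebraicClosure ℚ) (by exact_mod_cast hp.ne_zero)
  have hn₀ : ((p : ℤ) ^ k) ≠ 0 := pow_ne_zero _ (by exact_mod_cast hp.ne_zero)
  obtain ⟨n₁, hn₁⟩ := exists_threshold_mem_apply_eq_and_depth_pk_of_ne_two W p κ κ.invTwist hp2 hirr hns
    (ZpExtension.kerSubgroup_unitTwist κ (-1)) k
  refine ⟨n₁, fun n hn J J' hJ0 hJ hJ' φ ψ w hw S hS => ?_⟩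
  -- the governing subgroup `H' = joint kernel ⊓ ker ρ_{p^k}`: open, normal, `ker ρ_{p^k} ⊓ layer n ≤ H' ≤ ker ρ_{p^k}`
  set H₀ : Subgroup (absoluteGaloisGroup ℚ) :=
    (κ.twistModPRepresentation (W.torsionGaloisModule (p : ℤ))
        (fun P : geomTorsion W (p : ℤ) => AddSubgroup.torsionBy.nsmul P) J).ker ⊓
      (κ.invTwist.twistModPRepresentation (W.torsionGaloisModule (p : ℤ))
        (fun P : geomTorsion W (p : ℤ) => AddSubgroup.torsionBy.nsmul P) J').ker with hH₀def
  have hH'o : IsOpen (((H₀ ⊓ (galoisRepTorsion W ((p : ℤ) ^ k)).ker : Subgroup (absoluteGaloisGroup ℚ))) :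
      Set (absoluteGaloisGroup ℚ)) :=
    ((κ.isOpen_ker_twistModPRepresentation (W.torsionGaloisModule (p : ℤ)) _ J).inter
      (κ.invTwist.isOpen_ker_twistModPRepresentation (W.torsionGaloisModule (p : ℤ)) _ J')).inter
      (W.isOpen_ker_galoisRepTorsion_holds hn₀)
  have hle : (galoisRepTorsion W ((p : ℤ) ^ k)).ker ⊓ κ.layerSubgroup n ≤
      H₀ ⊓ (galoisRepTorsion W ((p : ℤ) ^ k)).ker := by
    refine le_inf (le_inf ?_ ?_) inf_le_left
    · exact (inf_le_inf_right _ (ker_galoisRepTorsion_pow_le W p hk)).trans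
        (ker_inf_layerSubgroup_le_ker_twistModPRepresentation W p κ hJ)
    · refine (inf_le_inf_right _ (ker_galoisRepTorsion_pow_le W p hk)).trans ?_
      rw [← ZpExtension.layerSubgroup_invTwist κ n]
      exact ker_inf_layerSubgroup_le_ker_twistModPRepresentation W p κ.invTwist hJ'
  -- the element
  obtain ⟨g, hgH, hφg, hψg, -, hgn, hgn1⟩ := hn₁ n hn J J' φ ψ (H₀ ⊓ (galoisRepTorsion W ((p : ℤ) ^ k)).ker)
    (fun _ hτ x => κ.toTopRep_ρ_apply_eq_self_of_mem_ker (W.torsionGaloisModule (p : ℤ)) _ J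
      (Subgroup.mem_inf.mp (Subgroup.mem_inf.mp hτ).1).1 x)
    (fun _ hτ y => κ.invTwist.toTopRep_ρ_apply_eq_self_of_mem_ker (W.torsionGaloisModule (p : ℤ)) _ J'
      (Subgroup.mem_inf.mp (Subgroup.mem_inf.mp hτ).1).2 y)
    hle inf_le_right hw
  -- the open normal subgroup `N`
  obtain ⟨N, hNn, hNo, hNH, hNL, hNφ, hNψ⟩ :=
    JointValue.exists_normal_isOpen_le_forall_apply_eq_zero φ ψ _
      (fun _ hτ x => κ.toTopRep_ρ_apply_eq_self_of_mem_ker (W.torsionGaloisModule (p : ℤ)) _ J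
        (Subgroup.mem_inf.mp (Subgroup.mem_inf.mp hτ).1).1 x)
      (fun _ hτ y => κ.invTwist.toTopRep_ρ_apply_eq_self_of_mem_ker (W.torsionGaloisModule (p : ℤ)) _ J'
        (Subgroup.mem_inf.mp (Subgroup.mem_inf.mp hτ).1).2 y)
      hH'o (κ.layerSubgroup (n + 1)) (κ.isOpen_layerSubgroup (n + 1)) (isOpen_discrete _) (isOpen_discrete _)
  haveI := hNn
  -- Chebotarev in `ℚ̄^N / ℚ` at the class of `g`
  obtain ⟨v, hvS, hunr, 𝔓, h𝔓, Fr, hFr, hFrg⟩ := exists_isArithFrobAt_mul_inv_mem_not_mem ℚ N hNo g S hS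
  obtain ⟨hFrH, hφFr⟩ := JointValue.mem_and_apply_eq_of_mul_inv_mem φ _
    (fun _ hτ x => κ.toTopRep_ρ_apply_eq_self_of_mem_ker (W.torsionGaloisModule (p : ℤ)) _ J
      (Subgroup.mem_inf.mp (Subgroup.mem_inf.mp hτ).1).1 x) hNH hNφ hgH hFrg
  obtain ⟨-, hψFr⟩ := JointValue.mem_and_apply_eq_of_mul_inv_mem ψ _
    (fun _ hτ y => κ.invTwist.toTopRep_ρ_apply_eq_self_of_mem_ker (W.torsionGaloisModule (p : ℤ)) _ J'
      (Subgroup.mem_inf.mp (Subgroup.mem_inf.mp hτ).1).2 y) hNH hNψ hgH hFrg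
  refine ⟨N, hNn, hNo, hNH, hNL, hNφ, hNψ, v, hvS, hunr, 𝔓, h𝔓, Fr, hFr, hFrH, hφFr.trans hφg, hψFr.trans hψg,
    ?_, ?_, ?_⟩
  · exact MonoidHom.mem_ker.mp (Subgroup.mem_inf.mp hFrH).2
  · exact (JointValue.mem_iff_mem_of_mul_inv_mem (hNL.trans (κ.layerSubgroup_antitone (Nat.le_succ n))) hFrg).mpr hgn
  · exact fun h => hgn1 ((JointValue.mem_iff_mem_of_mul_inv_mem hNL hFrg).mp h)

end Rat

end Summit.BirchSwinnertonDyer.BirchSwinnertonDyer.Theorems.OneSidedTwistSqueezeX9KatoDivisibilityX9ChebotarevPk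

end
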